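import Literature.Analysis.FluidPDE.ElgindiSupBounds
import Literature.Analysis.FluidPDE.ElgindiAngularHardy
import Literature.Analysis.FluidPDE.ElgindiPolarEnergy
import HarnessLib

/-!
# The `γ`-weighted angular Hardy inequality and the radial words against `sin(2θ)^{−γ}`
([Elgindi2021] §7.2 Lemma 7.2 "the original Hardy inequality", with the angular weights of §1.7.2)

Topic `Literature/Analysis/FluidPDE`. Proof file (everything proved, no definitions, no named
facts) on the proof path of the named fact
`Literature.Analysis.FluidPDE.Elgindi.ElgindiGhoulMasmoudi2021_stabilityCore`
(`ElgindiStabilityDecomposition.lean`). T. M. Elgindi, Ann. of Math. 194 (2021) =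
arXiv:1904.04795, §7.2 (p. 20) and §1.7.2 (p. 7); Elgindi–Ghoul–Masmoudi, arXiv:1910.14071, §1.7.

Hardy's inequality with power weights at the origin, `1 < γ`: for `f ∈ C¹` vanishing near `0`,
`∫₀ᵇ f²x^{−γ} ≤ (2/(γ−1))²∫₀ᵇ f′²x^{2−γ}` (`hardy_origin_rpow`), and its consequence on the strip:
for a test function `u`, `∫∫ w²u²s^{−γ} ≤ (π²/(γ−1)²)‖D_θu·W‖²` (`lintegral_sq_rpow_neg_gamma_le`),
so that the radial words `D_z^ju`, `j ≤ 3`, are controlled against the *angular* weight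
`sin(2θ)^{−γ}` by `|u|²_{𝓗⁴}` — the inequality that makes angular cut-offs harmless on the closure of
the test functions.
-/

noncomputable section

open MeasureTheory Set Function Real Filter intervalIntegral
open _root_.Topology
open scoped ENNReal

namespace Literature.Analysis.FluidPDE

namespace Elgindi

/-! ### Hardy's inequality with power weights at the origin -/

/-- **`∫₀ᵇ f²x^{−γ} ≤ (2/(γ−1))²∫₀ᵇ f′²x^{2−γ}`** for `f ∈ C¹` vanishing on `x < a` (`a > 0`), `1 < γ`,
`0 ≤ b`. [cite: Elgindi2021, §7.2 Lemma 7.2 ("the original Hardy inequality"), weighted form (p. 20 of arXiv:1904.04795)] -/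
theorem hardy_origin_rpow {f : ℝ → ℝ} (hf : ContDiff ℝ 1 f) {a : ℝ} (ha : 0 < a) (hfa : ∀ x < a, f x = 0) {γ : ℝ} (hγ : 1 < γ)
    {b : ℝ} (hb : 0 ≤ b) :
    ∫ x in (0:ℝ)..b, f x ^ 2 * x ^ (-γ) ≤ (2 / (γ - 1)) ^ 2 * ∫ x in (0:ℝ)..b, deriv f x ^ 2 * x ^ (2 - γ) := by
  have hd : Differentiable ℝ f := hf.differentiable (by simp)
  have hfc : Continuous f := hf.continuous
  have hdc : Continuous (deriv f) := hf.continuous_deriv le_rfl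
  have hda : ∀ x < a, deriv f x = 0 := fun x hx => by
    have h0 : f =ᶠ[𝓝 x] fun _ => 0 := Filter.eventuallyEq_of_mem (Iio_mem_nhds hx) fun y hy => hfa y hy
    rw [h0.deriv_eq, deriv_const]
  -- continuity of the two integrands on `ℝ` (they vanish near `x ≤ 0`)
  have cL : Continuous fun x => f x ^ 2 * x ^ (-γ) := by
    have e : (fun x => f x ^ 2 * x ^ (-γ)) = fun x => x ^ (-γ) * f x ^ 2 := by funext x; ring
    rw [e]
    exact continuous_mul_of_eq_zero_lt (u := fun x : ℝ => x ^ (-γ))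
      (fun x hx => (Real.continuousAt_rpow_const x _ (Or.inl hx)).continuousWithinAt) (hfc.pow 2) ha fun x hx => by simp [hfa x hx]
  have cR : Continuous fun x => deriv f x ^ 2 * x ^ (2 - γ) := by
    have e : (fun x => deriv f x ^ 2 * x ^ (2 - γ)) = fun x => x ^ (2 - γ) * deriv f x ^ 2 := by funext x; ring
    rw [e]
    exact continuous_mul_of_eq_zero_lt (u := fun x : ℝ => x ^ (2 - γ))
      (fun x hx => (Real.continuousAt_rpow_const x _ (Or.inl hx)).continuousWithinAt) (hdc.pow 2) ha fun x hx => by simp [hda x hx]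
  rcases le_or_gt b a with hba | hab
  · -- everything vanishes on `[0, b] ⊆ [0, a]`... only `x < a` vanish: handle `b ≤ a` via `b < a` or `b = a` by continuity
    have h0 : ∫ x in (0:ℝ)..b, f x ^ 2 * x ^ (-γ) = 0 := by
      refine intervalIntegral.integral_zero_ae (ae_of_all _ fun x hx => ?_)
      rw [uIoc_of_le hb] at hx
      rcases lt_or_eq_of_le (hx.2.trans hba) with h | h
      · simp [hfa x h]
      · -- `x = a`: `f a = 0` by continuity
        have : f a = 0 := by
          have ht : Tendsto f (𝓝[<] a) (𝓝 (f a)) := hfc.continuousAt.tendsto.mono_left nhdsWithin_le_nhds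
          have he : f =ᶠ[𝓝[<] a] fun _ => 0 := eventually_nhdsWithin_of_forall fun y hy => hfa y hy
          exact tendsto_nhds_unique ht (tendsto_const_nhds.congr' he.symm)
        simp [h, this]
    rw [h0]
    exact mul_nonneg (sq_nonneg _) (intervalIntegral.integral_nonneg hb fun x hx => mul_nonneg (sq_nonneg _) (Real.rpow_nonneg hx.1 _))
  -- `a < b`: work on `[ε, b]` with `ε = a/2`
  set ε := a / 2 with hε
  have hε0 : 0 < ε := by positivity
  have hεa : ε < a := by rw [hε]; linarith
  have hεb : ε ≤ b := by linarith
  set h : ℝ → ℝ := fun x => f x ^ 2 * x ^ (1 - γ) with hh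
  have hder : ∀ x ∈ uIcc ε b, HasDerivAt h (2 * f x * deriv f x * x ^ (1 - γ) + f x ^ 2 * ((1 - γ) * x ^ (1 - γ - 1))) x := by
    intro x hx
    rw [uIcc_of_le hεb] at hx
    have hx0 : 0 < x := hε0.trans_le hx.1
    have h1 : HasDerivAt (fun y => f y ^ 2) (2 * f x * deriv f x) x := by
      have e2 : (fun y => f y ^ 2) = fun y => f y * f y := by funext y; ring
      rw [e2]
      exact ((hd x).hasDerivAt.mul (hd x).hasDerivAt).congr_deriv (by ring)
    have h2 : HasDerivAt (fun y : ℝ => y ^ (1 - γ)) ((1 - γ) * x ^ (1 - γ - 1)) x := Real.hasDerivAt_rpow_const (Or.inl hx0.ne')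
    exact h1.mul h2
  have hcont' : ContinuousOn (fun x => 2 * f x * deriv f x * x ^ (1 - γ) + f x ^ 2 * ((1 - γ) * x ^ (1 - γ - 1))) (uIcc ε b) := by
    rw [uIcc_of_le hεb]
    have cp : ∀ e : ℝ, ContinuousOn (fun x : ℝ => x ^ e) (Icc ε b) := fun e x hx =>
      (Real.continuousAt_rpow_const x e (Or.inl (hε0.trans_le hx.1).ne')).continuousWithinAt
    exact ((by fun_prop : Continuous fun x => 2 * f x * deriv f x).continuousOn.mul (cp _)).add
      ((hfc.pow 2).continuousOn.mul (continuousOn_const.mul (cp _)))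
  have hFTC := integral_eq_sub_of_hasDerivAt hder hcont'.intervalIntegrable
  -- pointwise Young: `f²x^{-γ} ≤ (2/(γ-1))² f'²x^{2-γ} − (2/(γ-1)) h'`
  have hpt : ∀ x ∈ Icc ε b, f x ^ 2 * x ^ (-γ) ≤ (2 / (γ - 1)) ^ 2 * (deriv f x ^ 2 * x ^ (2 - γ)) -
      (2 / (γ - 1)) * (2 * f x * deriv f x * x ^ (1 - γ) + f x ^ 2 * ((1 - γ) * x ^ (1 - γ - 1))) := by
    intro x hx
    have hx0 : 0 < x := hε0.trans_le hx.1
    -- write everything with `p = x^{-γ/2}·f`, `q = x^{1-γ/2}·f'`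
    have e1 : x ^ (1 - γ) = x ^ (-γ / 2) * x ^ (1 - γ / 2) := by rw [← Real.rpow_add hx0]; ring_nf
    have e2 : x ^ (-γ) = x ^ (-γ / 2) * x ^ (-γ / 2) := by rw [← Real.rpow_add hx0]; ring_nf
    have e3 : x ^ (2 - γ) = x ^ (1 - γ / 2) * x ^ (1 - γ / 2) := by rw [← Real.rpow_add hx0]; ring_nf
    have e4 : x ^ (1 - γ - 1) = x ^ (-γ) := by ring_nf
    rw [e4, e1, e2, e3]
    set p := x ^ (-γ / 2) * f x
    set q := x ^ (1 - γ / 2) * deriv f x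
    have hγ1 : 0 < γ - 1 := by linarith
    have : f x ^ 2 * (x ^ (-γ / 2) * x ^ (-γ / 2)) = p ^ 2 := by simp only [p]; ring
    rw [this]
    have : deriv f x ^ 2 * (x ^ (1 - γ / 2) * x ^ (1 - γ / 2)) = q ^ 2 := by simp only [q]; ring
    rw [this]
    have : 2 * f x * deriv f x * (x ^ (-γ / 2) * x ^ (1 - γ / 2)) + f x ^ 2 * ((1 - γ) * (x ^ (-γ / 2) * x ^ (-γ / 2))) = 2 * p * q + (1 - γ) * p ^ 2 := by
      simp only [p, q]; ring
    rw [this]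
    have hid : (2 / (γ - 1)) ^ 2 * q ^ 2 - 2 / (γ - 1) * (2 * p * q + (1 - γ) * p ^ 2) - p ^ 2 = (2 / (γ - 1) * q - p) ^ 2 := by
      field_simp; ring
    nlinarith [sq_nonneg (2 / (γ - 1) * q - p), hid]
  have iL : IntervalIntegrable (fun x => f x ^ 2 * x ^ (-γ)) volume ε b := cL.intervalIntegrable _ _
  have iR : IntervalIntegrable (fun x => (2 / (γ - 1)) ^ 2 * (deriv f x ^ 2 * x ^ (2 - γ))) volume ε b := (cR.intervalIntegrable _ _).const_mul _
  have iH : IntervalIntegrable (fun x => (2 / (γ - 1)) * (2 * f x * deriv f x * x ^ (1 - γ) + f x ^ 2 * ((1 - γ) * x ^ (1 - γ - 1)))) volume ε b :=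
    hcont'.intervalIntegrable.const_mul _
  have hmono := intervalIntegral.integral_mono_on hεb iL (iR.sub iH) fun x hx => hpt x hx
  rw [intervalIntegral.integral_sub iR iH, intervalIntegral.integral_const_mul, intervalIntegral.integral_const_mul, hFTC] at hmono
  -- boundary terms: `h ε = 0`, `h b ≥ 0`
  have hhε : h ε = 0 := by simp only [hh]; rw [hfa ε hεa]; ring
  have hhb : 0 ≤ h b := by simp only [hh]; exact mul_nonneg (sq_nonneg _) (Real.rpow_nonneg (by linarith) _)
  have hγ1 : 0 < 2 / (γ - 1) := by apply div_pos; norm_num; linarith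
  -- the integrals over `(0, ε)` vanish
  have hL0 : ∫ x in (0:ℝ)..b, f x ^ 2 * x ^ (-γ) = ∫ x in ε..b, f x ^ 2 * x ^ (-γ) := by
    rw [← integral_add_adjacent_intervals (cL.intervalIntegrable 0 ε) iL]
    have : ∫ x in (0:ℝ)..ε, f x ^ 2 * x ^ (-γ) = 0 := intervalIntegral.integral_zero_ae (ae_of_all _ fun x hx => by
      rw [uIoc_of_le hε0.le] at hx; simp [hfa x (hx.2.trans_lt hεa)])
    rw [this, zero_add]
  have hR0 : ∫ x in (0:ℝ)..b, deriv f x ^ 2 * x ^ (2 - γ) = ∫ x in ε..b, deriv f x ^ 2 * x ^ (2 - γ) := by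
    rw [← integral_add_adjacent_intervals (cR.intervalIntegrable 0 ε) (cR.intervalIntegrable ε b)]
    have : ∫ x in (0:ℝ)..ε, deriv f x ^ 2 * x ^ (2 - γ) = 0 := intervalIntegral.integral_zero_ae (ae_of_all _ fun x hx => by
      rw [uIoc_of_le hε0.le] at hx; simp [hda x (hx.2.trans_lt hεa)])
    rw [this, zero_add]
  rw [hL0, hR0]
  nlinarith [hmono, hhb, hγ1, mul_nonneg hγ1.le hhb]

/-! ### The half-interval estimates with the weight `sin 2θ` -/

/-- Weight comparisons on `(0, π/4]`: `sin(2θ)^{−γ} ≤ (π/4)^γθ^{−γ}` and `θ^{2−γ} ≤ (π/4)^{2−γ}sin(2θ)^{2−γ}`. [folklore] -/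
theorem sin_rpow_compare {γ : ℝ} (hγ1 : 1 < γ) (hγ2 : γ ≤ 2) {θ : ℝ} (h0 : 0 < θ) (h1 : θ ≤ π / 4) :
    Real.sin (2 * θ) ^ (-γ) ≤ (π / 4) ^ γ * θ ^ (-γ) ∧ θ ^ (2 - γ) ≤ (π / 4) ^ (2 - γ) * Real.sin (2 * θ) ^ (2 - γ) := by
  have hs : 4 / π * θ ≤ Real.sin (2 * θ) := four_div_pi_mul_le_sin_two_mul h0.le h1
  have hπ : (0:ℝ) < π / 4 := by positivity
  have ht : 0 < 4 / π * θ := by positivity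
  have hs0 : 0 < Real.sin (2 * θ) := ht.trans_le hs
  constructor
  · -- `s^{-γ} ≤ (4θ/π)^{-γ} = (π/4)^γ θ^{-γ}`
    calc Real.sin (2 * θ) ^ (-γ) ≤ (4 / π * θ) ^ (-γ) := Real.rpow_le_rpow_of_nonpos ht hs (by linarith)
      _ = (π / 4) ^ γ * θ ^ (-γ) := by
          rw [Real.mul_rpow (by positivity) h0.le, show (4 / π : ℝ) = (π / 4)⁻¹ by field_simp, Real.inv_rpow hπ.le, ← Real.rpow_neg hπ.le, neg_neg]
  · -- `θ ≤ (π/4) s`, exponent `2 − γ ≥ 0`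
    have hθs : θ ≤ π / 4 * Real.sin (2 * θ) := by
      have := mul_le_mul_of_nonneg_left hs hπ.le
      rwa [show π / 4 * (4 / π * θ) = θ by field_simp] at this
    calc θ ^ (2 - γ) ≤ (π / 4 * Real.sin (2 * θ)) ^ (2 - γ) := Real.rpow_le_rpow h0.le hθs (by linarith)
      _ = (π / 4) ^ (2 - γ) * Real.sin (2 * θ) ^ (2 - γ) := Real.mul_rpow hπ.le hs0.le

/-- Continuity of `g²φ` when `g` is continuous, vanishes off `[a,b] ⊂ (0,π/2)`, and `φ` is continuous
on `(0,π/2)`. [folklore] -/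
theorem continuous_sq_mul_of_support {g : ℝ → ℝ} (hg : Continuous g) {a b : ℝ} (ha : 0 < a) (hb : b < π / 2)
    (hga : ∀ θ < a, g θ = 0) (hgb : ∀ θ, b < θ → g θ = 0) {φ : ℝ → ℝ} (hφ : ContinuousOn φ (Ioo 0 (π / 2))) :
    Continuous fun θ => g θ ^ 2 * φ θ := by
  refine continuous_iff_continuousAt.2 fun θ => ?_
  by_cases hθ : θ ∈ Ioo (a / 2) ((b + π / 2) / 2)
  · have hI : θ ∈ Ioo 0 (π / 2) := ⟨by linarith [hθ.1], by linarith [hθ.2]⟩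
    exact ((hg.pow 2).continuousAt).mul (hφ.continuousAt (isOpen_Ioo.mem_nhds hI))
  · -- near `θ` the function vanishes identically
    have hev : (fun θ => g θ ^ 2 * φ θ) =ᶠ[𝓝 θ] fun _ => 0 := by
      simp only [Set.mem_Ioo, not_and_or, not_lt] at hθ
      rcases hθ with h | h
      · filter_upwards [Iio_mem_nhds (show θ < a by linarith)] with t ht; simp [hga t ht]
      · filter_upwards [Ioi_mem_nhds (show b < θ by linarith)] with t ht; simp [hgb t ht]
    exact hev.continuousAt

/-- `sin 2θ` to a real power is continuous on `(0, π/2)`. [folklore] -/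
theorem continuousOn_sin_rpow (e : ℝ) : ContinuousOn (fun θ => Real.sin (2 * θ) ^ e) (Ioo 0 (π / 2)) := fun θ hθ => by
  have hs : Real.sin (2 * θ) ≠ 0 := (Real.sin_pos_of_pos_of_lt_pi (by linarith [hθ.1]) (by linarith [hθ.2])).ne'
  have hc : ContinuousAt (fun θ => Real.sin (2 * θ)) θ := (Real.continuous_sin.comp (continuous_const.mul continuous_id)).continuousAt
  exact (hc.rpow_const (Or.inl hs)).continuousWithinAt

/-- **The left half**: for `g ∈ C¹` vanishing off `[a,b] ⊂ (0,π/2)`,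
`∫₀^{π/4} g²sin(2θ)^{−γ} ≤ (π/4)²(2/(γ−1))²∫₀^{π/4} g′²sin(2θ)^{2−γ}` (`1 < γ ≤ 2`). [folklore] -/
theorem hardy_sin_left {g : ℝ → ℝ} (hg : ContDiff ℝ 1 g) {a b : ℝ} (ha : 0 < a) (hb : b < π / 2) (hga : ∀ θ < a, g θ = 0)
    (hgb : ∀ θ, b < θ → g θ = 0) {γ : ℝ} (hγ1 : 1 < γ) (hγ2 : γ ≤ 2) :
    ∫ θ in (0:ℝ)..(π / 4), g θ ^ 2 * Real.sin (2 * θ) ^ (-γ) ≤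
      (π / 4) ^ 2 * (2 / (γ - 1)) ^ 2 * ∫ θ in (0:ℝ)..(π / 4), deriv g θ ^ 2 * Real.sin (2 * θ) ^ (2 - γ) := by
  have hπ4 : (0:ℝ) ≤ π / 4 := by positivity
  have hgc : Continuous g := hg.continuous
  have hdc : Continuous (deriv g) := hg.continuous_deriv le_rfl
  have hda : ∀ x < a, deriv g x = 0 := fun x hx => by
    have h0 : g =ᶠ[𝓝 x] fun _ => 0 := Filter.eventuallyEq_of_mem (Iio_mem_nhds hx) fun y hy => hga y hy
    rw [h0.deriv_eq, deriv_const]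
  have hdb : ∀ x, b < x → deriv g x = 0 := fun x hx => by
    have h0 : g =ᶠ[𝓝 x] fun _ => 0 := Filter.eventuallyEq_of_mem (Ioi_mem_nhds hx) fun y hy => hgb y hy
    rw [h0.deriv_eq, deriv_const]
  have H := hardy_origin_rpow hg ha hga hγ1 hπ4
  -- continuity of the four integrands
  have hpow : ∀ e : ℝ, ContinuousOn (fun θ : ℝ => θ ^ e) (Ioo 0 (π / 2)) := fun e θ hθ =>
    (Real.continuousAt_rpow_const θ e (Or.inl hθ.1.ne')).continuousWithinAt
  have c1 := continuous_sq_mul_of_support hgc ha hb hga hgb (continuousOn_sin_rpow (-γ))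
  have c2 := continuous_sq_mul_of_support hdc ha hb hda hdb (continuousOn_sin_rpow (2 - γ))
  have c3 := continuous_sq_mul_of_support hgc ha hb hga hgb (hpow (-γ))
  have c4 := continuous_sq_mul_of_support hdc ha hb hda hdb (hpow (2 - γ))
  -- the two weight comparisons on `(0, π/4]`
  have step1 : ∫ θ in (0:ℝ)..(π / 4), g θ ^ 2 * Real.sin (2 * θ) ^ (-γ) ≤ (π / 4) ^ γ * ∫ θ in (0:ℝ)..(π / 4), g θ ^ 2 * θ ^ (-γ) := by
    rw [← intervalIntegral.integral_const_mul]
    refine intervalIntegral.integral_mono_on hπ4 (c1.intervalIntegrable _ _) ((c3.intervalIntegrable _ _).const_mul _) fun θ hθ => ?_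
    rcases eq_or_lt_of_le hθ.1 with h0 | h0
    · rw [← h0]; simp [hga 0 ha]
    · have := (sin_rpow_compare hγ1 hγ2 h0 hθ.2).1
      nlinarith [sq_nonneg (g θ), mul_le_mul_of_nonneg_left this (sq_nonneg (g θ))]
  have step3 : ∫ θ in (0:ℝ)..(π / 4), deriv g θ ^ 2 * θ ^ (2 - γ) ≤ (π / 4) ^ (2 - γ) * ∫ θ in (0:ℝ)..(π / 4), deriv g θ ^ 2 * Real.sin (2 * θ) ^ (2 - γ) := by
    rw [← intervalIntegral.integral_const_mul]
    refine intervalIntegral.integral_mono_on hπ4 (c4.intervalIntegrable _ _) ((c2.intervalIntegrable _ _).const_mul _) fun θ hθ => ?_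
    rcases eq_or_lt_of_le hθ.1 with h0 | h0
    · rw [← h0]; simp [hda 0 ha]
    · have := (sin_rpow_compare hγ1 hγ2 h0 hθ.2).2
      nlinarith [sq_nonneg (deriv g θ), mul_le_mul_of_nonneg_left this (sq_nonneg (deriv g θ))]
  have hK : 0 ≤ (2 / (γ - 1)) ^ 2 := sq_nonneg _
  have hI4 : 0 ≤ ∫ θ in (0:ℝ)..(π / 4), deriv g θ ^ 2 * Real.sin (2 * θ) ^ (2 - γ) :=
    intervalIntegral.integral_nonneg hπ4 fun θ hθ => mul_nonneg (sq_nonneg _) (Real.rpow_nonneg (by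
      rcases eq_or_lt_of_le hθ.1 with h0 | h0
      · rw [← h0]; simp
      · exact (Real.sin_pos_of_pos_of_lt_pi (by linarith) (by linarith [hθ.2, Real.pi_pos])).le) _)
  have e : (π / 4) ^ γ * (π / 4) ^ (2 - γ) = (π / 4) ^ 2 := by
    rw [← Real.rpow_add (by positivity)]; norm_num
  calc ∫ θ in (0:ℝ)..(π / 4), g θ ^ 2 * Real.sin (2 * θ) ^ (-γ)
      ≤ (π / 4) ^ γ * ((2 / (γ - 1)) ^ 2 * ((π / 4) ^ (2 - γ) * ∫ θ in (0:ℝ)..(π / 4), deriv g θ ^ 2 * Real.sin (2 * θ) ^ (2 - γ))) := by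
        refine step1.trans (mul_le_mul_of_nonneg_left (H.trans (mul_le_mul_of_nonneg_left step3 hK)) (by positivity))
    _ = (π / 4) ^ 2 * (2 / (γ - 1)) ^ 2 * ∫ θ in (0:ℝ)..(π / 4), deriv g θ ^ 2 * Real.sin (2 * θ) ^ (2 - γ) := by
        rw [← e]; ring

/-- **The right half** (reflection `θ ↦ π/2 − θ`): the same bound on `[π/4, π/2]`. [folklore] -/
theorem hardy_sin_right {g : ℝ → ℝ} (hg : ContDiff ℝ 1 g) {a b : ℝ} (ha : 0 < a) (hb : b < π / 2) (hga : ∀ θ < a, g θ = 0)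
    (hgb : ∀ θ, b < θ → g θ = 0) {γ : ℝ} (hγ1 : 1 < γ) (hγ2 : γ ≤ 2) :
    ∫ θ in (π / 4)..(π / 2), g θ ^ 2 * Real.sin (2 * θ) ^ (-γ) ≤
      (π / 4) ^ 2 * (2 / (γ - 1)) ^ 2 * ∫ θ in (π / 4)..(π / 2), deriv g θ ^ 2 * Real.sin (2 * θ) ^ (2 - γ) := by
  -- the reflected function
  set gr : ℝ → ℝ := fun φ => g (π / 2 - φ) with hgr
  have hgr1 : ContDiff ℝ 1 gr := hg.comp (contDiff_const.sub contDiff_id)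
  have hgra : ∀ φ < π / 2 - b, gr φ = 0 := fun φ hφ => hgb _ (by linarith)
  have hgrb : ∀ φ, π / 2 - a < φ → gr φ = 0 := fun φ hφ => hga _ (by linarith)
  have ha' : 0 < π / 2 - b := by linarith
  have hb' : π / 2 - a < π / 2 := by linarith
  have hd : ∀ φ, deriv gr φ = -deriv g (π / 2 - φ) := fun φ => by
    simp only [hgr]; rw [deriv_comp_const_sub (f := g) (a := π / 2) (x := φ)]
  have hsin : ∀ φ, Real.sin (2 * (π / 2 - φ)) = Real.sin (2 * φ) := fun φ => by
    rw [show 2 * (π / 2 - φ) = π - 2 * φ by ring, Real.sin_pi_sub]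
  have H := hardy_sin_left hgr1 ha' hb' hgra hgrb hγ1 hγ2
  -- change variables back
  have eL : ∫ θ in (π / 4)..(π / 2), g θ ^ 2 * Real.sin (2 * θ) ^ (-γ) = ∫ φ in (0:ℝ)..(π / 4), gr φ ^ 2 * Real.sin (2 * φ) ^ (-γ) := by
    have := intervalIntegral.integral_comp_sub_left (fun θ => g θ ^ 2 * Real.sin (2 * θ) ^ (-γ)) (π / 2) (a := 0) (b := π / 4)
    simp only [hsin] at this
    rw [show π / 2 - π / 4 = π / 4 by ring, sub_zero] at this
    rw [← this]
  have eR : ∫ θ in (π / 4)..(π / 2), deriv g θ ^ 2 * Real.sin (2 * θ) ^ (2 - γ) = ∫ φ in (0:ℝ)..(π / 4), deriv gr φ ^ 2 * Real.sin (2 * φ) ^ (2 - γ) := by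
    have := intervalIntegral.integral_comp_sub_left (fun θ => deriv g θ ^ 2 * Real.sin (2 * θ) ^ (2 - γ)) (π / 2) (a := 0) (b := π / 4)
    simp only [hsin] at this
    rw [show π / 2 - π / 4 = π / 4 by ring, sub_zero] at this
    rw [← this]
    refine intervalIntegral.integral_congr fun φ _ => ?_
    simp only [hd]; ring
  rw [eL, eR]; exact H

/-- **The `γ`-weighted angular Hardy inequality for slices of test functions**:
`∫₀^{π/2} g²sin(2θ)^{−γ} ≤ (π²/8)(2/(γ−1))²… ≤ (π/(γ−1))²∫₀^{π/2} g′²sin(2θ)^{2−γ}`. [folklore] -/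
theorem hardy_sin {g : ℝ → ℝ} (hg : ContDiff ℝ 1 g) {a b : ℝ} (ha : 0 < a) (hb : b < π / 2) (hga : ∀ θ < a, g θ = 0)
    (hgb : ∀ θ, b < θ → g θ = 0) {γ : ℝ} (hγ1 : 1 < γ) (hγ2 : γ ≤ 2) :
    ∫ θ in Ioo 0 (π / 2), g θ ^ 2 * Real.sin (2 * θ) ^ (-γ) ≤ (π / (γ - 1)) ^ 2 * ∫ θ in Ioo 0 (π / 2), deriv g θ ^ 2 * Real.sin (2 * θ) ^ (2 - γ) := by
  have hgc : Continuous g := hg.continuous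
  have hdc : Continuous (deriv g) := hg.continuous_deriv le_rfl
  have hda : ∀ x < a, deriv g x = 0 := fun x hx => by
    have h0 : g =ᶠ[𝓝 x] fun _ => 0 := Filter.eventuallyEq_of_mem (Iio_mem_nhds hx) fun y hy => hga y hy
    rw [h0.deriv_eq, deriv_const]
  have hdb : ∀ x, b < x → deriv g x = 0 := fun x hx => by
    have h0 : g =ᶠ[𝓝 x] fun _ => 0 := Filter.eventuallyEq_of_mem (Ioi_mem_nhds hx) fun y hy => hgb y hy
    rw [h0.deriv_eq, deriv_const]
  have c1 := continuous_sq_mul_of_support hgc ha hb hga hgb (continuousOn_sin_rpow (-γ))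
  have c2 := continuous_sq_mul_of_support hdc ha hb hda hdb (continuousOn_sin_rpow (2 - γ))
  have hL := hardy_sin_left hg ha hb hga hgb hγ1 hγ2
  have hR := hardy_sin_right hg ha hb hga hgb hγ1 hγ2
  have hπ : (0:ℝ) ≤ π / 2 := by positivity
  rw [← integral_Ioc_eq_integral_Ioo, ← intervalIntegral.integral_of_le hπ, ← integral_Ioc_eq_integral_Ioo, ← intervalIntegral.integral_of_le hπ,
    ← integral_add_adjacent_intervals (c1.intervalIntegrable 0 (π / 4)) (c1.intervalIntegrable (π / 4) (π / 2)),
    ← integral_add_adjacent_intervals (c2.intervalIntegrable 0 (π / 4)) (c2.intervalIntegrable (π / 4) (π / 2))]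
  have hI1 : 0 ≤ ∫ θ in (0:ℝ)..(π / 4), deriv g θ ^ 2 * Real.sin (2 * θ) ^ (2 - γ) :=
    intervalIntegral.integral_nonneg (by positivity) fun θ hθ => mul_nonneg (sq_nonneg _) (Real.rpow_nonneg (by
      rcases eq_or_lt_of_le hθ.1 with h0 | h0
      · rw [← h0]; simp
      · exact (Real.sin_pos_of_pos_of_lt_pi (by linarith) (by linarith [hθ.2, Real.pi_pos])).le) _)
  have hI2 : 0 ≤ ∫ θ in (π / 4)..(π / 2), deriv g θ ^ 2 * Real.sin (2 * θ) ^ (2 - γ) :=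
    intervalIntegral.integral_nonneg (by linarith [Real.pi_pos]) fun θ hθ => mul_nonneg (sq_nonneg _) (Real.rpow_nonneg (by
      rcases eq_or_lt_of_le hθ.2 with h0 | h0
      · rw [h0, show 2 * (π / 2) = π by ring, Real.sin_pi]
      · exact (Real.sin_pos_of_pos_of_lt_pi (by linarith [hθ.1, Real.pi_pos]) (by linarith)).le) _)
  have hc : (π / 4) ^ 2 * (2 / (γ - 1)) ^ 2 ≤ (π / (γ - 1)) ^ 2 := by
    rw [show (π / 4) ^ 2 * (2 / (γ - 1)) ^ 2 = (π / (γ - 1)) ^ 2 * (1 / 4) by field_simp; ring]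
    nlinarith [sq_nonneg (π / (γ - 1))]
  nlinarith [hL, hR, mul_le_mul_of_nonneg_right hc hI1, mul_le_mul_of_nonneg_right hc hI2]

/-! ### On the strip -/

/-- A compactly supported function with support inside `(0, π/2)` vanishes off some `[a,b] ⊂ (0,π/2)`. [folklore] -/
theorem exists_support_bounds_Ioo {g : ℝ → ℝ} (hs : HasCompactSupport g) (hsub : tsupport g ⊆ Ioo 0 (π / 2)) :
    ∃ a b : ℝ, 0 < a ∧ b < π / 2 ∧ (∀ θ < a, g θ = 0) ∧ ∀ θ, b < θ → g θ = 0 := by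
  by_cases hne : (tsupport g).Nonempty
  · have hK := hs.isCompact
    refine ⟨sInf (tsupport g), sSup (tsupport g), (hsub (hK.sInf_mem hne)).1, (hsub (hK.sSup_mem hne)).2, fun θ hθ => ?_, fun θ hθ => ?_⟩
    · exact image_eq_zero_of_notMem_tsupport fun h => (not_le.2 hθ) (csInf_le hK.bddBelow h)
    · exact image_eq_zero_of_notMem_tsupport fun h => (not_le.2 hθ) (le_csSup hK.bddAbove h)
  · rw [Set.not_nonempty_iff_eq_empty] at hne
    refine ⟨π / 4, π / 4, by positivity, by linarith [Real.pi_pos], fun θ _ => ?_, fun θ _ => ?_⟩ <;>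
      exact image_eq_zero_of_notMem_tsupport (by rw [hne]; exact notMem_empty θ)

/-- **The radial words against the angular weight**: for a test function `u` and `0 < α ≤ 10`,
`∫∫_strip w²u²sin(2θ)^{−γ} ≤ (π/(γ−1))²·‖D_θu·W‖²_{L²(strip)}`. [cite: Elgindi2021, §7.2 Lemma 7.2 with the weights of §1.7.2 (pp. 7, 20 of arXiv:1904.04795)] -/
theorem lintegral_sq_rpow_neg_gamma_le {α : ℝ} (hα : 0 < α) (hα10 : α ≤ 10) {u : ℝ → ℝ → ℝ} (hu : StripTest u) :
    ∫⁻ p in strip, ENNReal.ofReal (radialWeight p.1 ^ 2 * (u p.1 p.2) ^ 2 * Real.sin (2 * p.2) ^ (-gammaExp α)) ≤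
      ENNReal.ofReal ((π / (gammaExp α - 1)) ^ 2) * eL2Sq (hkMixedTerm α 1 0 u) := by
  set γ := gammaExp α with hγ
  have hγ1 : 1 < γ := by unfold gammaExp at hγ; rw [hγ]; linarith
  have hγ2 : γ ≤ 2 := by unfold gammaExp at hγ; rw [hγ]; linarith
  set C : ℝ := (π / (γ - 1)) ^ 2 with hC
  have hC0 : 0 ≤ C := sq_nonneg _
  -- measurability
  have mw : Measurable fun q : ℝ × ℝ => radialWeight q.1 := by unfold radialWeight; fun_prop
  have mL : Measurable fun q : ℝ × ℝ => ENNReal.ofReal (radialWeight q.1 ^ 2 * (u q.1 q.2) ^ 2 * Real.sin (2 * q.2) ^ (-γ)) := by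
    have c1 : Measurable fun q : ℝ × ℝ => u q.1 q.2 := (hu.smooth 0).continuous.measurable
    have c3 : Measurable fun q : ℝ × ℝ => Real.sin (2 * q.2) ^ (-γ) := by fun_prop
    exact (((mw.pow_const 2).mul (c1.pow_const 2)).mul c3).ennreal_ofReal
  have mR : Measurable fun q : ℝ × ℝ => ENNReal.ofReal (radialWeight q.1 ^ 2 * (dθ u q.1 q.2) ^ 2 * Real.sin (2 * q.2) ^ (2 - γ)) := by
    have c1 : Measurable fun q : ℝ × ℝ => dθ u q.1 q.2 := (hu.ofdθ.smooth 0).continuous.measurable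
    have c3 : Measurable fun q : ℝ × ℝ => Real.sin (2 * q.2) ^ (2 - γ) := by fun_prop
    exact (((mw.pow_const 2).mul (c1.pow_const 2)).mul c3).ennreal_ofReal
  -- slice inequality in `ℝ≥0∞`
  have hslice : ∀ z, ∫⁻ t in Ioo 0 (π / 2), ENNReal.ofReal (radialWeight z ^ 2 * (u z t) ^ 2 * Real.sin (2 * t) ^ (-γ)) ≤
      ENNReal.ofReal C * ∫⁻ t in Ioo 0 (π / 2), ENNReal.ofReal (radialWeight z ^ 2 * (dθ u z t) ^ 2 * Real.sin (2 * t) ^ (2 - γ)) := by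
    intro z
    obtain ⟨h1, h2, h3⟩ := hu.slice_θ z
    obtain ⟨a, b, ha, hb, hga, hgb⟩ := exists_support_bounds_Ioo h2 h3
    have H := hardy_sin h1 ha hb hga hgb hγ1 hγ2
    have hd : ∀ t, deriv (fun θ => u z θ) t = dθ u z t := fun t => rfl
    simp only [hd] at H
    have hgc : Continuous fun θ => u z θ := h1.continuous
    have hdc : Continuous fun θ => dθ u z θ := h1.continuous_deriv le_rfl
    have hda : ∀ x < a, dθ u z x = 0 := fun x hx => by
      have h0 : (fun θ => u z θ) =ᶠ[𝓝 x] fun _ => 0 := Filter.eventuallyEq_of_mem (Iio_mem_nhds hx) fun y hy => hga y hy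
      show deriv (fun θ => u z θ) x = 0; rw [h0.deriv_eq, deriv_const]
    have hdb : ∀ x, b < x → dθ u z x = 0 := fun x hx => by
      have h0 : (fun θ => u z θ) =ᶠ[𝓝 x] fun _ => 0 := Filter.eventuallyEq_of_mem (Ioi_mem_nhds hx) fun y hy => hgb y hy
      show deriv (fun θ => u z θ) x = 0; rw [h0.deriv_eq, deriv_const]
    have cL := continuous_sq_mul_of_support hgc ha hb hga hgb (continuousOn_sin_rpow (-γ))
    have cR := continuous_sq_mul_of_support hdc ha hb hda hdb (continuousOn_sin_rpow (2 - γ))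
    have iL : IntegrableOn (fun t => u z t ^ 2 * Real.sin (2 * t) ^ (-γ)) (Ioo 0 (π / 2)) := cL.integrableOn_Icc.mono_set Ioo_subset_Icc_self
    have iR : IntegrableOn (fun t => dθ u z t ^ 2 * Real.sin (2 * t) ^ (2 - γ)) (Ioo 0 (π / 2)) := cR.integrableOn_Icc.mono_set Ioo_subset_Icc_self
    have nL : ∀ t ∈ Ioo (0:ℝ) (π / 2), 0 ≤ u z t ^ 2 * Real.sin (2 * t) ^ (-γ) := fun t ht =>
      mul_nonneg (sq_nonneg _) (Real.rpow_nonneg (Real.sin_pos_of_pos_of_lt_pi (by linarith [ht.1]) (by linarith [ht.2])).le _)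
    have nR : ∀ t ∈ Ioo (0:ℝ) (π / 2), 0 ≤ dθ u z t ^ 2 * Real.sin (2 * t) ^ (2 - γ) := fun t ht =>
      mul_nonneg (sq_nonneg _) (Real.rpow_nonneg (Real.sin_pos_of_pos_of_lt_pi (by linarith [ht.1]) (by linarith [ht.2])).le _)
    -- pull the constant `w(z)²` out of both sides
    have eL : ∫⁻ t in Ioo 0 (π / 2), ENNReal.ofReal (radialWeight z ^ 2 * (u z t) ^ 2 * Real.sin (2 * t) ^ (-γ)) =
        ENNReal.ofReal (radialWeight z ^ 2) * ENNReal.ofReal (∫ t in Ioo 0 (π / 2), u z t ^ 2 * Real.sin (2 * t) ^ (-γ)) := by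
      rw [ofReal_integral_eq_lintegral_ofReal iL ((ae_restrict_iff' measurableSet_Ioo).2 (ae_of_all _ nL)), ← lintegral_const_mul' _ _ ENNReal.ofReal_ne_top]
      refine lintegral_congr fun t => ?_
      rw [← ENNReal.ofReal_mul (sq_nonneg _)]; congr 1; ring
    have eR : ∫⁻ t in Ioo 0 (π / 2), ENNReal.ofReal (radialWeight z ^ 2 * (dθ u z t) ^ 2 * Real.sin (2 * t) ^ (2 - γ)) =
        ENNReal.ofReal (radialWeight z ^ 2) * ENNReal.ofReal (∫ t in Ioo 0 (π / 2), dθ u z t ^ 2 * Real.sin (2 * t) ^ (2 - γ)) := by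
      rw [ofReal_integral_eq_lintegral_ofReal iR ((ae_restrict_iff' measurableSet_Ioo).2 (ae_of_all _ nR)), ← lintegral_const_mul' _ _ ENNReal.ofReal_ne_top]
      refine lintegral_congr fun t => ?_
      rw [← ENNReal.ofReal_mul (sq_nonneg _)]; congr 1; ring
    rw [eL, eR, mul_left_comm, ← ENNReal.ofReal_mul hC0]
    exact mul_le_mul_right (ENNReal.ofReal_le_ofReal H) _
  -- integrate in `z`
  calc ∫⁻ p in strip, ENNReal.ofReal (radialWeight p.1 ^ 2 * (u p.1 p.2) ^ 2 * Real.sin (2 * p.2) ^ (-γ))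
      = ∫⁻ z in Ioi 0, ∫⁻ t in Ioo 0 (π / 2), ENNReal.ofReal (radialWeight z ^ 2 * (u z t) ^ 2 * Real.sin (2 * t) ^ (-γ)) := lintegral_strip_eq_radial_theta mL
    _ ≤ ∫⁻ z in Ioi 0, ENNReal.ofReal C * ∫⁻ t in Ioo 0 (π / 2), ENNReal.ofReal (radialWeight z ^ 2 * (dθ u z t) ^ 2 * Real.sin (2 * t) ^ (2 - γ)) :=
        lintegral_mono fun z => hslice z
    _ = ENNReal.ofReal C * ∫⁻ p in strip, ENNReal.ofReal (radialWeight p.1 ^ 2 * (dθ u p.1 p.2) ^ 2 * Real.sin (2 * p.2) ^ (2 - γ)) := by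
        rw [lintegral_const_mul' _ _ ENNReal.ofReal_ne_top, lintegral_strip_eq_radial_theta mR]
    _ = ENNReal.ofReal C * eL2Sq (hkMixedTerm α 1 0 u) := by
        congr 1
        rw [eL2Sq_eq_lintegral_ofReal]
        refine setLIntegral_congr_fun measurableSet_strip fun p hp => ?_
        rw [sq_hkMixedTerm_one α 0 u hp]; rfl

/-- **The radial words `D_z^ju`, `j ≤ 3`, of a test function against `sin(2θ)^{−γ}` are bounded by
`(π/(γ−1))²|u|²_{𝓗⁴}`.** [folklore] -/
theorem lintegral_radialWord_rpow_neg_gamma_le {α : ℝ} (hα : 0 < α) (hα10 : α ≤ 10) {u : ℝ → ℝ → ℝ} (hu : StripTest u) {j : ℕ} (hj : j ≤ 3) :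
    ∫⁻ p in strip, ENNReal.ofReal (radialWeight p.1 ^ 2 * ((Dz^[j] u) p.1 p.2) ^ 2 * Real.sin (2 * p.2) ^ (-gammaExp α)) ≤
      ENNReal.ofReal ((π / (gammaExp α - 1)) ^ 2) * eHkNormSq α 4 u := by
  have h := lintegral_sq_rpow_neg_gamma_le hα hα10 (hu.ofWord 0 j)
  simp only [Function.iterate_zero, id_eq] at h
  refine h.trans (mul_le_mul_right ?_ _)
  have e : ∀ p ∈ strip, hkMixedTerm α 1 0 (Dz^[j] u) p.1 p.2 = hkMixedTerm α 1 j u p.1 p.2 := fun p _ => rfl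
  rw [eL2Sq_congr_strip e]
  exact eL2Sq_hkMixedTerm_le α le_rfl (by omega) u

end Elgindi

end Literature.Analysis.FluidPDE
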